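import Mathlib
import HarnessLib
import Summits.HubbardSuperconductivity.HubbardSuperconductivity.Theorems.KLProgrammeKLRegimeCountertermJacksonLowBernstein

/-!
# Route `KLProgramme`, crux K3 — `L¹` bounds for the derivatives of the `2π`-periodic Jackson kernel (MS-A34-ter (K1))

Seat hubbard-kl-k3c3-p1 (g4).  The mixed Jackson–Bernstein bound (`…CountertermJacksonMixedBernstein`, abstract kernel form) charges `(d+1)` per kernel
derivative in `L¹([−π, π])`.  For the Jackson kernel `J̃_d = Φ²/(2π·c)`, `Φ(s) = F_d(s/2π) = Σ_{h ≤ d} f_h cos(h s)` (`fejer_two_pi`), `c = jacksonConst d ≥ 8(d+1)/π⁴`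
(`jacksonConst_ge`), this is elementary: the derivatives of `Φ` are finite sine/cosine sums with coefficients `f_h h^r` (`|f_h| ≤ 2`), their squares
integrate to `≤ 2π Σ (f_h h^r)² ≤ 8π(d+1)^{2r+1}` (orthogonality `integral_cos_mul_cos` / `integral_sin_mul_sin`), and the products in
`J̃′ = 2ΦΦ′/(2πc)`, `J̃″ = 2(Φ′² + ΦΦ″)/(2πc)`, `J̃‴ = 2(3Φ′Φ″ + ΦΦ‴)/(2πc)` are handled by the weighted AM–GM inequality `|xy| ≤ (t x² + y²/t)/2` with
`t = (d+1)^{Δ}` (no Cauchy–Schwarz machinery):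

  `∫|J̃_d| = 1`,  `∫|J̃_d′| ≤ π⁴(d+1)`,  `∫|J̃_d″| ≤ 2π⁴(d+1)²`,  `∫|J̃_d‴| ≤ 4π⁴(d+1)³`.

This part: `Φ` and `Φ₁…Φ₄` as trigonometric sums with their `HasDerivAt` chain; `jker` is `C^∞` (`contDiff_jker`); the iterated-derivative family
`jkerD d a := deriv^[a] (jker d)` with `HasDerivAt (jkerD d a) (jkerD d (a+1) s) s`, continuity, periodicity, and the closed forms of `jkerD d 1/2/3`.
The integral bounds are in part 2 (`…JacksonKernelL1`).  Pure real analysis; nothing about the model.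
-/

noncomputable section

namespace Summit.HubbardSuperconductivity.HubbardSuperconductivity.Theorems.KLRegimeSplit

set_option linter.dupNamespace false -- summit = problem name (single-conjunct summit), D-0017

open Real Finset MeasureTheory intervalIntegral Literature.Analysis.Fourier.TrigApprox

/-! ## §1 The Fejér profile `Φ` and its first three derivatives as trigonometric sums -/

/-- `Φ_d(s) = F_d(s/2π)`. -/
def fejerP (d : ℕ) (s : ℝ) : ℝ := fejer d (s / (2 * π))

/-- `Φ′(s) = −Σ f_h h sin(h s)`. -/
def fejerP1 (d : ℕ) (s : ℝ) : ℝ := ∑ h ∈ range (d + 1), fejerCoeff d h * (-(h : ℝ) * Real.sin (h * s))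

/-- `Φ″(s) = −Σ f_h h² cos(h s)`. -/
def fejerP2 (d : ℕ) (s : ℝ) : ℝ := ∑ h ∈ range (d + 1), fejerCoeff d h * (-(h : ℝ) ^ 2 * Real.cos (h * s))

/-- `Φ‴(s) = Σ f_h h³ sin(h s)`. -/
def fejerP3 (d : ℕ) (s : ℝ) : ℝ := ∑ h ∈ range (d + 1), fejerCoeff d h * ((h : ℝ) ^ 3 * Real.sin (h * s))

/-- `Φ⁗(s) = Σ f_h h⁴ cos(h s)`. -/
def fejerP4 (d : ℕ) (s : ℝ) : ℝ := ∑ h ∈ range (d + 1), fejerCoeff d h * ((h : ℝ) ^ 4 * Real.cos (h * s))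

/-- `Φ` as a cosine sum. -/
theorem fejerP_eq (d : ℕ) (s : ℝ) : fejerP d s = ∑ h ∈ range (d + 1), fejerCoeff d h * Real.cos (h * s) := fejer_two_pi d s

/-- `d/ds cos(h s) = −h sin(h s)`. -/
theorem hasDerivAt_cos_natMul (h : ℕ) (s : ℝ) : HasDerivAt (fun s : ℝ => Real.cos (h * s)) (-(h : ℝ) * Real.sin (h * s)) s := by
  have hc := ((hasDerivAt_id s).const_mul (h : ℝ)).cos
  convert hc using 1 <;> simp [mul_comm]

/-- `d/ds sin(h s) = h cos(h s)`. -/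
theorem hasDerivAt_sin_natMul (h : ℕ) (s : ℝ) : HasDerivAt (fun s : ℝ => Real.sin (h * s)) ((h : ℝ) * Real.cos (h * s)) s := by
  have hc := ((hasDerivAt_id s).const_mul (h : ℝ)).sin
  convert hc using 1 <;> simp [mul_comm]

/-- `Φ′ = Φ₁`. -/
theorem hasDerivAt_fejerP (d : ℕ) (s : ℝ) : HasDerivAt (fejerP d) (fejerP1 d s) s := by
  have hfun : fejerP d = fun s => ∑ h ∈ range (d + 1), fejerCoeff d h * Real.cos (h * s) := funext (fejerP_eq d)
  rw [hfun]; unfold fejerP1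
  exact HasDerivAt.fun_sum fun h _ => (hasDerivAt_cos_natMul h s).const_mul (fejerCoeff d h)

/-- `Φ₁′ = Φ₂`. -/
theorem hasDerivAt_fejerP1 (d : ℕ) (s : ℝ) : HasDerivAt (fejerP1 d) (fejerP2 d s) s := by
  unfold fejerP1 fejerP2
  refine HasDerivAt.fun_sum fun h _ => ?_
  exact (((hasDerivAt_sin_natMul h s).const_mul (-(h : ℝ))).const_mul (fejerCoeff d h)).congr_deriv (by ring)

/-- `Φ₂′ = Φ₃`. -/
theorem hasDerivAt_fejerP2 (d : ℕ) (s : ℝ) : HasDerivAt (fejerP2 d) (fejerP3 d s) s := by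
  unfold fejerP2 fejerP3
  refine HasDerivAt.fun_sum fun h _ => ?_
  exact (((hasDerivAt_cos_natMul h s).const_mul (-(h : ℝ) ^ 2)).const_mul (fejerCoeff d h)).congr_deriv (by ring)

/-- `Φ₃′ = Φ₄`. -/
theorem hasDerivAt_fejerP3 (d : ℕ) (s : ℝ) : HasDerivAt (fejerP3 d) (fejerP4 d s) s := by
  unfold fejerP3 fejerP4
  refine HasDerivAt.fun_sum fun h _ => ?_
  exact (((hasDerivAt_sin_natMul h s).const_mul ((h : ℝ) ^ 3)).const_mul (fejerCoeff d h)).congr_deriv (by ring)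

/-- `Φ` is continuous. -/
theorem continuous_fejerP (d : ℕ) : Continuous (fejerP d) := by
  rw [show fejerP d = fun s => ∑ h ∈ range (d + 1), fejerCoeff d h * Real.cos (h * s) from funext (fejerP_eq d)]; fun_prop
/-- `Φ₁` is continuous. -/
theorem continuous_fejerP1 (d : ℕ) : Continuous (fejerP1 d) := by unfold fejerP1; fun_prop
/-- `Φ₂` is continuous. -/
theorem continuous_fejerP2 (d : ℕ) : Continuous (fejerP2 d) := by unfold fejerP2; fun_prop
/-- `Φ₃` is continuous. -/
theorem continuous_fejerP3 (d : ℕ) : Continuous (fejerP3 d) := by unfold fejerP3; fun_prop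
/-- `Φ₄` is continuous. -/
theorem continuous_fejerP4 (d : ℕ) : Continuous (fejerP4 d) := by unfold fejerP4; fun_prop

/-! ## §2 The kernel `J̃_d = Φ²/(2πc)` and its derivatives -/

/-- `J̃_d(s) = Φ(s)² / (2π c)`. -/
theorem jker_eq_fejerP_sq (d : ℕ) (s : ℝ) : jker d s = fejerP d s ^ 2 / (jacksonConst d * (2 * π)) := by
  unfold jker jackson fejerP; rw [div_div]

/-- `J̃′ = 2ΦΦ′/(2πc)`. -/
def jkerD1 (d : ℕ) (s : ℝ) : ℝ := 2 * fejerP d s * fejerP1 d s / (jacksonConst d * (2 * π))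
/-- `J̃″ = 2(Φ′² + ΦΦ″)/(2πc)`. -/
def jkerD2 (d : ℕ) (s : ℝ) : ℝ := 2 * (fejerP1 d s ^ 2 + fejerP d s * fejerP2 d s) / (jacksonConst d * (2 * π))
/-- `J̃‴ = 2(3Φ′Φ″ + ΦΦ‴)/(2πc)`. -/
def jkerD3 (d : ℕ) (s : ℝ) : ℝ := 2 * (3 * fejerP1 d s * fejerP2 d s + fejerP d s * fejerP3 d s) / (jacksonConst d * (2 * π))
/-- `J̃⁗ = 2(3Φ″² + 4Φ′Φ‴ + ΦΦ⁗)/(2πc)`. -/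
def jkerD4 (d : ℕ) (s : ℝ) : ℝ :=
  2 * (3 * fejerP2 d s ^ 2 + 4 * fejerP1 d s * fejerP3 d s + fejerP d s * fejerP4 d s) / (jacksonConst d * (2 * π))

/-- `J̃′ = jkerD1`. -/
theorem hasDerivAt_jker (d : ℕ) (s : ℝ) : HasDerivAt (jker d) (jkerD1 d s) s := by
  have hfun : jker d = fun s => fejerP d s * fejerP d s / (jacksonConst d * (2 * π)) :=
    funext fun s => by rw [jker_eq_fejerP_sq, sq]
  rw [hfun]
  exact (((hasDerivAt_fejerP d s).mul (hasDerivAt_fejerP d s)).div_const (jacksonConst d * (2 * π))).congr_deriv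
    (by unfold jkerD1; ring)

/-- `jkerD1′ = jkerD2`. -/
theorem hasDerivAt_jkerD1 (d : ℕ) (s : ℝ) : HasDerivAt (jkerD1 d) (jkerD2 d s) s := by
  have hfun : jkerD1 d = fun s => 2 * fejerP d s * fejerP1 d s / (jacksonConst d * (2 * π)) := rfl
  rw [hfun]
  exact ((((hasDerivAt_fejerP d s).const_mul 2).mul (hasDerivAt_fejerP1 d s)).div_const (jacksonConst d * (2 * π))).congr_deriv
    (by unfold jkerD2; ring)

/-- `jkerD2′ = jkerD3`. -/
theorem hasDerivAt_jkerD2 (d : ℕ) (s : ℝ) : HasDerivAt (jkerD2 d) (jkerD3 d s) s := by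
  have hfun : jkerD2 d = fun s => 2 * (fejerP1 d s * fejerP1 d s + fejerP d s * fejerP2 d s) / (jacksonConst d * (2 * π)) :=
    funext fun s => by unfold jkerD2; rw [sq]
  rw [hfun]
  exact (((((hasDerivAt_fejerP1 d s).mul (hasDerivAt_fejerP1 d s)).add ((hasDerivAt_fejerP d s).mul (hasDerivAt_fejerP2 d s))).const_mul
    2).div_const (jacksonConst d * (2 * π))).congr_deriv (by unfold jkerD3; ring)

/-- `jkerD3′ = jkerD4`. -/
theorem hasDerivAt_jkerD3 (d : ℕ) (s : ℝ) : HasDerivAt (jkerD3 d) (jkerD4 d s) s := by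
  have hfun : jkerD3 d = fun s => 2 * (3 * fejerP1 d s * fejerP2 d s + fejerP d s * fejerP3 d s) / (jacksonConst d * (2 * π)) := rfl
  rw [hfun]
  exact ((((((hasDerivAt_fejerP1 d s).const_mul 3).mul (hasDerivAt_fejerP2 d s)).add
    ((hasDerivAt_fejerP d s).mul (hasDerivAt_fejerP3 d s))).const_mul 2).div_const (jacksonConst d * (2 * π))).congr_deriv
    (by unfold jkerD4; ring)

/-! ## §3 `J̃_d` is smooth; the iterated-derivative family -/

/-- `J̃_d` is `C^∞` (a finite cosine sum). -/
theorem contDiff_jker (d : ℕ) : ContDiff ℝ (⊤ : ℕ∞) (jker d) := by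
  rw [show jker d = fun s => ∑ m ∈ range (d + d + 1), jkerCoeff d m * Real.cos (m * s) from funext (jker_eq_cosPoly d)]
  fun_prop

/-- **The iterated-derivative family of the kernel**: `jkerD d a = deriv^[a] J̃_d`. -/
def jkerD (d a : ℕ) : ℝ → ℝ := deriv^[a] (jker d)

/-- `jkerD d 0 = J̃_d`. -/
theorem jkerD_zero (d : ℕ) : jkerD d 0 = jker d := rfl

/-- Every member of the family is smooth. -/
theorem contDiff_jkerD (d a : ℕ) : ContDiff ℝ (⊤ : ℕ∞) (jkerD d a) := (contDiff_jker d).iterate_deriv a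

/-- Every member of the family is continuous. -/
theorem continuous_jkerD (d a : ℕ) : Continuous (jkerD d a) := (contDiff_jkerD d a).continuous

/-- Each member is the derivative of the previous one. -/
theorem jkerD_succ (d a : ℕ) : jkerD d (a + 1) = deriv (jkerD d a) := by
  show deriv^[a + 1] (jker d) = deriv (deriv^[a] (jker d)); rw [Function.iterate_succ']; rfl

/-- Each member is the derivative of the previous one (pointwise). -/
theorem hasDerivAt_jkerD (d a : ℕ) (s : ℝ) : HasDerivAt (jkerD d a) (jkerD d (a + 1) s) s := by
  rw [jkerD_succ]
  exact ((contDiff_jkerD d a).differentiable (by simp)).differentiableAt.hasDerivAt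

/-- The derivative of a periodic function is periodic. -/
theorem periodic_deriv {f : ℝ → ℝ} {c : ℝ} (hf : Function.Periodic f c) : Function.Periodic (deriv f) c := by
  intro x
  have hfun : (fun y => f (y + c)) = f := funext hf
  rw [← deriv_comp_add_const, hfun]

/-- Each member is `2π`-periodic. -/
theorem jkerD_periodic (d a : ℕ) : Function.Periodic (jkerD d a) (2 * π) := by
  induction a with
  | zero => exact jker_periodic d
  | succ a ih => rw [jkerD_succ]; exact periodic_deriv ih

/-- Closed form of the first derivative. -/
theorem jkerD_one (d : ℕ) : jkerD d 1 = jkerD1 d := by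
  funext s; rw [jkerD_succ, jkerD_zero]; exact (hasDerivAt_jker d s).deriv
/-- Closed form of the second derivative. -/
theorem jkerD_two (d : ℕ) : jkerD d 2 = jkerD2 d := by
  funext s; rw [jkerD_succ, jkerD_one]; exact (hasDerivAt_jkerD1 d s).deriv
/-- Closed form of the third derivative. -/
theorem jkerD_three (d : ℕ) : jkerD d 3 = jkerD3 d := by
  funext s; rw [jkerD_succ, jkerD_two]; exact (hasDerivAt_jkerD2 d s).deriv

end Summit.HubbardSuperconductivity.HubbardSuperconductivity.Theorems.KLRegimeSplit

end
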